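import Literature.Computability.QuantumComplexity.ClassicalWrapReadout
import HarnessLib

/-!
# The classical-wrap circuit family: layout and stages

The circuit family behind the named fact
`Literature.Computability.Cryptography.isQSolvable_classicalWrap` (`Cryptography/ShorProofs.lean`:
bounded-error quantum search solvability is closed under deterministic polynomial-time
pre-processing `h` and post-processing `g`; Bernstein–Vazirani 1997, §8; Nielsen–Chuang 2010,
§3.2.5, §4.4, §4.5.5). Given a uniform oracle-free Clifford+T family `F` solving the search
problem `R` and machines `Mh`, `Mg` for `h` and for the post-processor (time `(n+2)^e`), the
circuit for input length `n` must run `F` on `h x`, whose *length* `L = |h x| < B(n)` depends on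
`x`. **Design (time multiplexing with uncomputation).** All candidate copies `F.circ m`,
`m < B(n)`, act on the *same* front wires `0 … bmax(n) - 1` (so that their descriptions are
those of `F` verbatim, for uniformity), one after the other; copy `m` is followed by a copy of
the front into the post-processing zone *controlled on the length flag* `[m = L]` and by the
inverse circuit `(F.circ m).inv` (`CliffordTInverse.lean`). For `m ≠ L` the iteration is
exactly the identity (`UncomputeBranches.iteration_eq_self`); for `m = L` it is Bennett's
compute–copy–uncompute, leaving `∑_y ψ(y) (F⁻¹|y⟩) ⊗ |⟨x, y⟩⟩_zone`.

Register layout for input length `n` (all positions closed affine forms, `WrapData.*`):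
front `[0, bmax)` (`bmax = n + B + (B+2)^eF`, `B = RevClean.JJ eh Mh n`); the clean block of
`Mh` (`RevUncompute.lean`) shifted to `R0 = bmax`, its data being a copy of `x`; length flags
`R2 + m` (`RevMux.flagOps` on the blank-code wires of the block's read-out); the control wire
`cur = R3`; the post-processing zone / clean block of `Mg` shifted to `R4 = R3 + 1` with data
length `Dg = 2n + 2 + 2 bmax + 2` (the `boolPair ⟨x, y⟩` code); plain output bits `R5 + j`.

Stages (`ClOp ℕ` programs, compiled by `revCompile`): `preOps` = move `x` behind the front,
run the `h`-block, load `h x` onto the front (`xorLayer` over the `true`-code wires,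
`ClassicalWrapReadout.lean`), raise the flags, write `dbl x ++ [0,1]` into the zone; per
iteration `curOps` (flag to `cur`), the gates of `F.circ m` / `(F.circ m).inv` transported to
the front (`mapWires`, `Fin.castLEEmb`), `copyOps` (`copyGz`); `postOps` = run the `g`-block on
the zone, decode its plain output bits, swap them onto the wires `0, 1, …` (`RevMux.swapOps`).
This file fixes the data (`WrapData`), the layout with its separation lemmas and the stage
programs; well-formedness and wire bounds (`ClassicalWrapWF.lean`), the compiled circuit and the
family (`ClassicalWrapCircuit.lean`), semantics and uniformity are the subject of the sequels.

## References

* E. Bernstein, U. Vazirani, *Quantum complexity theory*, SIAM J. Comput. 26 (1997), §8.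
* C. H. Bennett, E. Bernstein, G. Brassard, U. Vazirani, *Strengths and weaknesses of quantum
  computing*, SIAM J. Comput. 26 (1997), Thm. 4.14 (proof).
* M. A. Nielsen, I. L. Chuang, *Quantum Computation and Quantum Information*, CUP 2010,
  §3.2.5, §4.4, §4.5.5.
* S. Arora, B. Barak, *Computational Complexity: A Modern Approach*, CUP 2009, §6.2, §10.3.7.
-/

noncomputable section

namespace Literature.Computability.QuantumComplexity

namespace ClassicalWrap

open Turing Function Cryptography Complexity Complexity.FinTM2Sim RevSim RevClean

/-! ### Data -/

/-- The data of the classical wrap: the given family `F`, the machines of the pre- and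
post-processing with their time exponents, and the ancilla exponent of `F`
(`F.ancillas m ≤ (m+2)^eF`). [cite: BernsteinVazirani1997, §8] -/
structure WrapData where
  /-- the given uniform family solving the search problem -/
  F : QCircuitFamily cliffordT
  /-- time exponent of the pre-processor machine -/
  eh : ℕ
  /-- the pre-processor machine -/
  Mh : TM2ComputableAux Bool Bool
  /-- ancilla exponent of `F` -/
  eF : ℕ
  /-- time exponent of the post-processor machine -/
  eg : ℕ
  /-- the post-processor machine -/
  Mg : TM2ComputableAux Bool Bool

/-! ### Compiling `ℕ`-wired programs -/

/-- Compile a well-formed `ℕ`-wired program using wires `< N` to Clifford+T on `N` wires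
(`finOf` re-indexing, `toRevList`, `revCompile`). [cite: AroraBarak2009, §10.3.7 Lemma 10.10] -/
def compileOps (N : ℕ) (hN : 0 < N) (ops : List (ClOp ℕ)) (hwf : ∀ op ∈ ops, op.WF)
    (hlt : ∀ op ∈ ops, ∀ i ∈ wiresOf op, i < N) : List (QGate cliffordT N) :=
  revCompile (toRevList (ops.map (ClOp.map (finOf N hN))) fun op' hop' => by
    obtain ⟨op, hop, rfl⟩ := List.mem_map.1 hop'
    exact wf_map_finOf hN (hlt op hop) (hwf op hop))

/-- Compiled programs are oracle-free. [folklore] -/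
theorem compileOps_isOracleFree (N : ℕ) (hN : 0 < N) (ops : List (ClOp ℕ)) (hwf : ∀ op ∈ ops, op.WF)
    (hlt : ∀ op ∈ ops, ∀ i ∈ wiresOf op, i < N) : ∀ g ∈ compileOps N hN ops hwf hlt, g.IsOracleFree :=
  revCompile_isOracleFree _

namespace WrapData

variable (D : WrapData)

/-! ### Layout -/

/-- Number of candidate lengths: `|h x| < B` for `|x| = n` (`RevClean.JJ`). [folklore] -/
def B (n : ℕ) : ℕ := JJ D.eh D.Mh n

/-- The number of flags minus one (`B - 1`; `B ≥ 1`). [folklore] -/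
def Lsel (n : ℕ) : ℕ := D.B n - 1

/-- The width of circuit `m` of `F` (reducible, so that `bF |h x|` and the index of
`F.circ |h x|` agree syntactically up to reducible unfolding). [folklore] -/
abbrev bF (m : ℕ) : ℕ := m + D.F.ancillas m

/-- The front width `bmax = n + B + (B+2)^eF` (room for `F.circ m`, `m < B`). [folklore] -/
def bmax (n : ℕ) : ℕ := n + (D.B n + (D.B n + 2) ^ D.eF)

/-- Base of the `h`-block (its data wires hold the copy of `x`). [folklore] -/
def R0 (n : ℕ) : ℕ := D.bmax n

/-- Width of the `h`-block (`RevClean.width`). [folklore] -/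
def WH (n : ℕ) : ℕ := width D.eh D.Mh n

/-- Base of the length flags. [folklore] -/
def R2 (n : ℕ) : ℕ := D.R0 n + D.WH n

/-- The control wire `cur`. [folklore] -/
def R3 (n : ℕ) : ℕ := D.R2 n + D.B n

/-- Base of the post-processing zone (= base of the `g`-block). [folklore] -/
def R4 (n : ℕ) : ℕ := D.R3 n + 1

/-- Data length of the `g`-block: `|boolPair x (boolPair y pad)|` with `|y| ≤ bmax`. [folklore] -/
def Dg (n : ℕ) : ℕ := 2 * n + 2 + (2 * D.bmax n + 2)

/-- The first wire of the `y`-part of the zone. [folklore] -/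
def gzd (n : ℕ) : ℕ := D.R4 n + (2 * n + 2)

/-- Width of the `g`-block. [folklore] -/
def WG (n : ℕ) : ℕ := width D.eg D.Mg (D.Dg n)

/-- Base of the plain output bits. [folklore] -/
def R5 (n : ℕ) : ℕ := D.R4 n + D.WG n

/-- Number of plain output bits (`RevClean.JJ` of the `g`-block). [folklore] -/
def JG (n : ℕ) : ℕ := JJ D.eg D.Mg (D.Dg n)

/-- Number of ancilla wires. [folklore] -/
def anc (n : ℕ) : ℕ := (D.B n + (D.B n + 2) ^ D.eF) + D.WH n + D.B n + 1 + D.WG n + D.JG n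

/-- Total number of wires `n + anc n`. [folklore] -/
abbrev Wtot (n : ℕ) : ℕ := n + D.anc n

/-! ### Layout arithmetic -/

section Arith

variable {D} (n : ℕ)

/-- `1 ≤ B`. [folklore] -/
theorem one_le_B : 1 ≤ D.B n := by
  have := one_le_dd D.Mh.tm
  show 1 ≤ JJ D.eh D.Mh n
  simp only [JJ]; omega

/-- `Lsel + 1 = B`. [folklore] -/
theorem Lsel_add_one : D.Lsel n + 1 = D.B n := by
  have := one_le_B (D := D) n
  show D.B n - 1 + 1 = D.B n
  omega

/-- `JG ≤ WG` (the plain bits are fewer than the wires of the `g`-block). [folklore] -/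
theorem JG_le_WG : D.JG n ≤ D.WG n := by
  show JJ D.eg D.Mg (D.Dg n) ≤ width D.eg D.Mg (D.Dg n)
  simp only [width, copyN]
  have := one_le_A₁ (M := D.Mg)
  calc JJ D.eg D.Mg (D.Dg n) ≤ JJ D.eg D.Mg (D.Dg n) * A₁ D.Mg := Nat.le_mul_of_pos_right _ this
    _ ≤ _ := Nat.le_add_left _ _

/-- **The layout equations and inequalities**, as one conjunction for `omega`: the bases are
the running sums of the widths, the `h`-block contains `n` data wires and its tableau, the
`g`-block contains its `Dg` data wires, the total width ends after the plain bits. [folklore] -/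
theorem layout :
    D.bmax n = n + (D.B n + (D.B n + 2) ^ D.eF) ∧ D.R0 n = D.bmax n ∧ D.R2 n = D.R0 n + D.WH n ∧
    n ≤ NN D.eh D.Mh n ∧ NN D.eh D.Mh n ≤ D.WH n ∧ D.R3 n = D.R2 n + D.B n ∧ D.R4 n = D.R3 n + 1 ∧
    D.gzd n = D.R4 n + (2 * n + 2) ∧ D.Dg n = 2 * n + 2 + (2 * D.bmax n + 2) ∧ D.R5 n = D.R4 n + D.WG n ∧
    D.Dg n ≤ NN D.eg D.Mg (D.Dg n) ∧ NN D.eg D.Mg (D.Dg n) ≤ D.WG n ∧ D.JG n ≤ D.WG n ∧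
    D.Wtot n = D.R5 n + D.JG n ∧ 1 ≤ D.B n :=
  ⟨rfl, rfl, rfl, le_NN n, NN_le_width n, rfl, rfl, rfl, rfl, rfl, le_NN _, NN_le_width _, JG_le_WG n,
    by simp only [Wtot, anc, R5, R4, R3, R2, R0, bmax]; omega, one_le_B n⟩

/-- `bF m ≤ bmax n` for `m < B n`, given the ancilla bound. [folklore] -/
theorem bF_le_bmax (hanc : ∀ m, D.F.ancillas m ≤ (m + 2) ^ D.eF) {m : ℕ} (hm : m < D.B n) : D.bF m ≤ D.bmax n := by
  have h1 := hanc m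
  have h2 : (m + 2) ^ D.eF ≤ (D.B n + 2) ^ D.eF := Nat.pow_le_pow_left (by omega) _
  show m + D.F.ancillas m ≤ n + (D.B n + (D.B n + 2) ^ D.eF)
  omega

/-- `0 < Wtot`. [folklore] -/
theorem Wtot_pos : 0 < D.Wtot n := by
  obtain ⟨h1, h2, h3, h4, h5, h6, h7, h8, h9, h10, h11, h12, h13, h14, h15⟩ := layout (D := D) n; omega

/-- `bmax ≤ Wtot`. [folklore] -/
theorem bmax_le_Wtot : D.bmax n ≤ D.Wtot n := by
  obtain ⟨h1, h2, h3, h4, h5, h6, h7, h8, h9, h10, h11, h12, h13, h14, h15⟩ := layout (D := D) n; omega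

/-- Result wires of the `h`-block, in absolute position, lie in `[R0 + NN, R2)`. [folklore] -/
theorem resW_h_bounds {j : ℕ} (hj : j < D.B n) (a : OSym D.Mh) :
    D.R0 n + NN D.eh D.Mh n ≤ D.R0 n + resW D.eh D.Mh n j a ∧ D.R0 n + resW D.eh D.Mh n j a < D.R2 n := by
  have h1 := NN_le_resW (e := D.eh) (M := D.Mh) n j a
  have h2 := resW_lt_width (e := D.eh) (M := D.Mh) (n := n) hj a
  obtain ⟨-, -, h3, -⟩ := layout (D := D) n
  change D.R2 n = D.R0 n + width D.eh D.Mh n at h3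
  omega

/-- Result wires of the `g`-block, in absolute position, lie in `[R4 + NN, R5)`. [folklore] -/
theorem resW_g_bounds {j : ℕ} (hj : j < D.JG n) (a : OSym D.Mg) :
    D.R4 n + NN D.eg D.Mg (D.Dg n) ≤ D.R4 n + resW D.eg D.Mg (D.Dg n) j a ∧
      D.R4 n + resW D.eg D.Mg (D.Dg n) j a < D.R5 n := by
  have h1 := NN_le_resW (e := D.eg) (M := D.Mg) (D.Dg n) j a
  have h2 := resW_lt_width (e := D.eg) (M := D.Mg) (n := D.Dg n) hj a
  obtain ⟨-, -, -, -, -, -, -, -, -, h3, -⟩ := layout (D := D) n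
  change D.R5 n = D.R4 n + width D.eg D.Mg (D.Dg n) at h3
  omega

/-- `R0 + resW` is injective in `(j, a)`. [folklore] -/
theorem resW_h_inj {j j' : ℕ} {a a' : OSym D.Mh}
    (h : D.R0 n + resW D.eh D.Mh n j a = D.R0 n + resW D.eh D.Mh n j' a') : j = j' ∧ a = a' :=
  resW_inj (Nat.add_left_cancel h)

end Arith

/-! ### The stage programs -/

section Stages

variable (n : ℕ)

/-- Stage 0: move `x` from the front to the data wires of the `h`-block (copy, then cancel).
[Nielsen–Chuang 2010, §3.2.5] [cite: NielsenChuang2010, §3.2.5] -/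
def moveOps : List (ClOp ℕ) :=
  xorLayer (List.range n) (fun i => [i]) (fun i => D.R0 n + i) ++
    xorLayer (List.range n) (fun i => [D.R0 n + i]) (fun i => i)

/-- Stage 1: the clean block of `Mh` on its copy of `x`, shifted to `R0`.
[cite: NielsenChuang2010, §3.2.5] -/
def hBlock : List (ClOp ℕ) := (cleanOps D.eh D.Mh n []).map (ClOp.map (· + D.R0 n))

/-- Stage 2a: load the plain bits of `h x` onto the front (`true`-code wires of the read-out,
XORed onto front wire `i`). [folklore] -/
def loadOps : List (ClOp ℕ) :=
  xorLayer (List.range (D.B n)) (fun i => (trueCodes D.Mh).map fun a => D.R0 n + resW D.eh D.Mh n i a) fun i => i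

/-- Stage 2b: the one-hot length flags from the blank-code wires (`RevMux.flagOps`). [folklore] -/
def flagOps' : List (ClOp ℕ) :=
  RevMux.flagOps (fun j => D.R0 n + resW D.eh D.Mh n j none) (fun m => D.R2 n + m) (D.Lsel n)

/-- Stage 3: write `dbl x ++ [0, 1]` (the first half of `boolPair x _`) into the zone. [folklore] -/
def gzInit : List (ClOp ℕ) :=
  xorLayer (List.range (2 * n)) (fun k => [D.R0 n + k / 2]) (fun k => D.R4 n + k) ++ [ClOp.not (D.R4 n + (2 * n + 1))]

/-- **The pre-processing stage.** [cite: BernsteinVazirani1997, §8] -/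
def preOps : List (ClOp ℕ) := D.moveOps n ++ D.hBlock n ++ D.loadOps n ++ D.flagOps' n ++ D.gzInit n

/-- Per iteration: XOR the flag of length `m` onto `cur` (before and after the copy). [folklore] -/
def curOps (m : ℕ) : List (ClOp ℕ) := [ClOp.cnot (D.R2 n + m) (D.R3 n)]

/-- Per iteration: the `cur`-controlled copy of the front of width `b` into the zone, in pair
format (`ClassicalWrap.copyGz`). [cite: NielsenChuang2010, §3.2.5] -/
abbrev copyOps' (b : ℕ) : List (ClOp ℕ) := copyGz (D.R3 n) id (fun k => D.gzd n + k) b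

/-- Stage 5: the clean block of `Mg` on the zone, shifted to `R4`. [cite: NielsenChuang2010, §3.2.5] -/
def gBlock : List (ClOp ℕ) := (cleanOps D.eg D.Mg (D.Dg n) []).map (ClOp.map (· + D.R4 n))

/-- Stage 6: decode the plain output bits of the `g`-block onto the wires `R5 + j`. [folklore] -/
def obOps : List (ClOp ℕ) :=
  xorLayer (List.range (D.JG n)) (fun j => (trueCodes D.Mg).map fun a => D.R4 n + resW D.eg D.Mg (D.Dg n) j a)
    fun j => D.R5 n + j

/-- Stage 7: swap the plain output bits onto the wires `0 … JG - 1` (`RevMux.swapOps`, pairs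
`(R5 + j, j)`). [cite: NielsenChuang2010, §1.3.4] -/
def swapOps' : List (ClOp ℕ) := RevMux.swapOps ((List.range (D.JG n)).map fun j => (D.R5 n + j, j))

/-- **The post-processing stage.** [cite: BernsteinVazirani1997, §8] -/
def postOps : List (ClOp ℕ) := D.gBlock n ++ D.obOps n ++ D.swapOps' n

end Stages

end WrapData

end ClassicalWrap

end Literature.Computability.QuantumComplexity
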